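import Mathlib
import Summits.NavierStokesRegularity.FluidComputer.TransportGalerkinLevelGenerators
import HarnessLib

/-!
# The transport Galerkin model: exact eigenvectors and the eigen-consistency hypothesis (instab g18, cell `ns-blowup`, 2026-08-27)

HONEST FRAMING (human ruling D-0035): nothing here is a claim about Navier–Stokes blow-up.
WHAT THIS IS NOT: not NS evidence — the EIGEN DICTIONARY of the (β2) chain
(`TransportGalerkinDefs … TransportGalerkinAbc`, `HOME/instab/BETA2-SPEC.md` §10 (6)): the two
eigen hypotheses of the KEEP sentence `TransportGalerkinBilinearLoss.half_prediction_nsField''` /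
`TransportGalerkinAbc.half_prediction_abc`,

* an exact eigenvector `v` of the linearised operator `A = linOp ν Uv π P` on the `H²`-scaled phase
  space `E = ℓ²(ℤ^d; V)`, and
* the eigen-consistency at the cube levels
  `hres : ‖P_n (A (P_n v)) − λ P_n v‖ → 0`,

READ OFF the coefficient-level eigen-equation. General finite `d`, Hilbert `V`, rapidly
decreasing host `Uv`, coordinate functionals `π_j` of norm `≤ 1`, modewise contractions `P(k)`.

* §1 `linOp_eq_smul_of_coeff` — if the unscaled family `û = Λ⁻² ⇑x` of a rapidly decreasing
  `x ∈ E` solves `P(k) (linCoeff ν Uv π û)(k) = μ • û(k)` for every mode `k`, then `A x = μ • x`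
  (`coe_linOp_of_rapidDecay` + `Λ² Λ⁻² = 1`); real form `linOp_eq_real_smul_of_coeff`; the modewise
  equation is homogeneous (`coeff_eigen_const_smul`, from `TransportGalerkinLevelGenerators.linCoeff_smul`).
* §2 `eNormSq_linOp_sub_le` — `‖A x − A y‖²_E ≤ K_lin² · ‖⇑x − ⇑y‖²₂` on rapidly decreasing
  elements, `K_lin` the `H⁴ → H²` constant of `TransportGalerkinContinuity.eNorm_two_linCoeff_le`
  (`linCoeff_sub` for the linearity); hence **`tendsto_eigen_residual`**: for a rapidly decreasing
  exact eigenvector, `A v = λ v` (`λ ∈ ℝ`), the hypothesis `hres` HOLDS —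
  `P_n (A (P_n v)) − λ P_n v = P_n (A (P_n v) − A v)` and `‖⇑(P_n v) − ⇑v‖₂² = ∑_{k ∉ cube n} ⟨k⟩⁴‖v k‖² → 0`
  (`LatticeSobolevSmooth.tendsto_eNormSq_sub_trunc`, cofinality of the cubes).
* §3 `smul_mem_box` — real multiples `ε • x` of an element satisfying the three linear constraints
  of `box ρ π P` lie in the box as soon as `|ε|·‖x k‖ ≤ ρ k` modewise; for a rapidly decreasing `x`
  and radii bounded below by a polynomial, `C⟨k⟩^{−s} ≤ ρ k`, this holds for all small `ε`
  (`exists_smul_mem_box_of_rapidDecay`) — the seed hypothesis `ε • v ∈ Z ⊆ W` is satisfiable.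

Mathlib + the tree files cited; no new definitions.
-/

noncomputable section

namespace Summit.NavierStokesRegularity.FluidComputer.TransportGalerkinEigen

open Set Filter Topology Finset
open Literature.Analysis.FunctionSpaces Literature.Analysis.FunctionSpaces.Lattice
open Literature.Analysis.FunctionSpaces.Torus Literature.Analysis.ODE
open Summit.NavierStokesRegularity.FluidComputer.GalerkinLatticePhaseSpace
open Summit.NavierStokesRegularity.FluidComputer.TransportGalerkin
open Summit.NavierStokesRegularity.FluidComputer.TransportSkewLattice
open Summit.NavierStokesRegularity.FluidComputer.TransportGalerkinRapid
open Summit.NavierStokesRegularity.FluidComputer.TransportGalerkinContinuity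
open Summit.NavierStokesRegularity.FluidComputer.TransportGalerkinLevelGenerators
open scoped ENNReal NNReal ComplexConjugate InnerProductSpace

variable {d : Type*} [Fintype d] [DecidableEq d]
variable {V : Type*} [NormedAddCommGroup V] [InnerProductSpace ℂ V] [CompleteSpace V]
variable {ν : ℝ} {Uv : (d → ℤ) → V} {π : d → (V →L[ℂ] ℂ)} {P : (d → ℤ) → (V →L[ℂ] V)}

/-! ## §1 Exact eigenvectors from the coefficient eigen-equation -/

section Exact

omit [DecidableEq d] [CompleteSpace V] in
/-- The weights cancel: `⟨k⟩² • (⟨k⟩⁻² • v) = v`. -/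
theorem weight_two_smul_weight_neg_two (k : d → ℤ) (v : V) :
    (sobolevWeight 2 k : ℂ) • ((sobolevWeight (-2) k : ℂ) • v) = v := by
  rw [smul_smul, ← Complex.ofReal_mul, sobolevWeight_neg,
    mul_inv_cancel₀ (sobolevWeight_pos 2 k).ne', Complex.ofReal_one, one_smul]

omit [DecidableEq d] in
/-- **Exact eigenvectors at the coefficient level.** If the unscaled family `û = Λ⁻² ⇑x` of a
rapidly decreasing `x ∈ E` solves the modewise eigen-equation `P(k) (linCoeff ν Uv π û)(k) = μ • û(k)`
for every `k`, then `linOp ν Uv π P x = μ • x`. -/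
theorem linOp_eq_smul_of_coeff (hUv : RapidDecay Uv) (hP : ∀ k, ‖P k‖ ≤ 1)
    {x : lp (fun _ : (d → ℤ) => V) 2} (hx : RapidDecay (⇑x)) {μ : ℂ}
    (heig : ∀ k, P k (linCoeff ν Uv π (wmul (-2) ⇑x) k) = μ • wmul (-2) (⇑x) k) :
    linOp ν Uv π P x = μ • x := by
  apply lp.ext
  rw [coe_linOp_of_rapidDecay hUv hP hx, lp.coeFn_smul]
  funext k
  rw [wmul_apply, heig k, Pi.smul_apply, wmul_apply, smul_comm, weight_two_smul_weight_neg_two]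

omit [DecidableEq d] in
/-- The same with a real eigenvalue and the real scalar action on `E`. -/
theorem linOp_eq_real_smul_of_coeff (hUv : RapidDecay Uv) (hP : ∀ k, ‖P k‖ ≤ 1)
    {x : lp (fun _ : (d → ℤ) => V) 2} (hx : RapidDecay (⇑x)) {μ : ℝ}
    (heig : ∀ k, P k (linCoeff ν Uv π (wmul (-2) ⇑x) k) = (μ : ℂ) • wmul (-2) (⇑x) k) :
    linOp ν Uv π P x = μ • x := by
  rw [linOp_eq_smul_of_coeff hUv hP hx heig]
  apply lp.ext
  rw [lp.coeFn_smul, lp.coeFn_smul]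
  funext k
  simp only [Pi.smul_apply, Complex.coe_smul]

omit [Fintype d] [DecidableEq d] [CompleteSpace V] in
/-- The modewise eigen-equation is homogeneous: if `û` solves `P(k)(lin û)(k) = μ û(k)` then so does
`z • û`. -/
theorem coeff_eigen_const_smul [Fintype d] {u : (d → ℤ) → V} {μ : ℂ}
    (heig : ∀ k, P k (linCoeff ν Uv π u k) = μ • u k) (z : ℂ) (k : d → ℤ) :
    P k (linCoeff ν Uv π (z • u) k) = μ • (z • u) k := by
  rw [linCoeff_smul, Pi.smul_apply, map_smul, heig k, Pi.smul_apply, smul_comm]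

end Exact

/-! ## §2 The eigen-consistency hypothesis `hres` for rapidly decreasing exact eigenvectors -/

section Consistency

omit [DecidableEq d] in
/-- **`linOp` is `H⁴ → H²`-Lipschitz in unscaled coefficients**, i.e. on rapidly decreasing elements
`‖⇑(A x − A y)‖₀² ≤ K_lin² · ‖⇑x − ⇑y‖₂²` with the constant of `eNorm_two_linCoeff_le`. -/
theorem eNormSq_linOp_sub_le (hUv : RapidDecay Uv) (hπ : ∀ j, ‖π j‖ ≤ 1) (hP : ∀ k, ‖P k‖ ≤ 1)
    {x y : lp (fun _ : (d → ℤ) => V) 2} (hx : RapidDecay (⇑x)) (hy : RapidDecay (⇑y)) :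
    eNormSq 0 (⇑(linOp ν Uv π P x - linOp ν Uv π P y)) ≤
      (‖(ν : ℂ)‖ₑ * ((Fintype.card d : ℝ≥0∞) * (ENNReal.ofReal (2 * Real.pi) * ENNReal.ofReal (2 * Real.pi)))
        + (∑ j, ENNReal.ofReal ((2 : ℝ) ^ (|(2 : ℝ)| / 2)) *
            symbNorm |(2 : ℝ)| (scal (fun p => π j (Uv p)) : (d → ℤ) → (V →L[ℂ] V))) * ENNReal.ofReal (2 * Real.pi)
        + 2 * ((Fintype.card d : ℝ≥0∞) * ENNReal.ofReal (2 * Real.pi)) *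
            (∑' l, ENNReal.ofReal (sobolevWeight 3 l) * ‖Uv l‖ₑ)) ^ 2 * eNormSq 2 (⇑x - ⇑y) := by
  have hxu : RapidDecay (wmul (-2) (⇑x)) := rapidDecay_wmul hx (-2)
  have hyu : RapidDecay (wmul (-2) (⇑y)) := rapidDecay_wmul hy (-2)
  have hcoe : ⇑(linOp ν Uv π P x - linOp ν Uv π P y) =
      wmul 2 (fun k => P k (linCoeff ν Uv π (wmul (-2) (⇑x - ⇑y)) k)) := by
    rw [lp.coeFn_sub, coe_linOp_of_rapidDecay hUv hP hx, coe_linOp_of_rapidDecay hUv hP hy, ← wmul_sub,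
      wmul_sub (-2) (⇑x) (⇑y), linCoeff_sub hUv π hxu hyu]
    congr 1
    funext k
    simp only [Pi.sub_apply, map_sub]
  have h4 : eNormSq 2 (⇑x - ⇑y) = eNorm 4 (wmul (-2) (⇑x - ⇑y)) ^ 2 := by
    rw [eNorm_pow_two, eNormSq_wmul]; norm_num
  rw [hcoe, eNormSq_wmul, zero_add, h4, ← mul_pow]
  refine (eNormSq_apply_le_of_opNorm_le_one P hP 2 _).trans ?_
  rw [← eNorm_pow_two]
  gcongr
  exact eNorm_two_linCoeff_le hπ _

omit [CompleteSpace V] in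
/-- The cube truncations of an element of `E` converge to it in the lattice `H^s` norm as soon as
that norm is finite: `‖⇑v − ⇑(P_n v)‖ₛ² → 0` (cofinality of the cubes in
`LatticeSobolevSmooth.tendsto_eNormSq_sub_trunc`). -/
theorem tendsto_eNormSq_sub_cubeProj {s : ℝ} {v : lp (fun _ : (d → ℤ) => V) 2} (hv : eNormSq s (⇑v) < ∞) :
    Tendsto (fun n : ℕ => eNormSq s (⇑v - ⇑(cubeProj n v))) atTop (𝓝 0) := by
  have h := (tendsto_eNormSq_sub_trunc hv).comp
    (Monotone.tendsto_atTop_atTop (fun n m h => cube_mono (d := d) h) fun s => exists_subset_cube s)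
  refine h.congr fun n => ?_
  simp only [Function.comp_apply, cubeProj_eq, coe_lpProj_eq_trunc]

omit [DecidableEq d] [InnerProductSpace ℂ V] [CompleteSpace V] in
/-- Norms in `E` from the lattice `H⁰` norm: if `‖⇑z‖₀² ≤ b < ∞` then `‖z‖ ≤ √(b.toReal)`. -/
theorem norm_le_sqrt_toReal {z : lp (fun _ : (d → ℤ) => V) 2} {b : ℝ≥0∞} (hb : b ≠ ∞)
    (h : eNormSq 0 (⇑z) ≤ b) : ‖z‖ ≤ Real.sqrt b.toReal := by
  rw [← Real.sqrt_sq (norm_nonneg z), norm_sq_eq_toReal_eNormSq_zero]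
  exact Real.sqrt_le_sqrt (ENNReal.toReal_mono hb h)

/-- **The eigen-consistency hypothesis `hres` holds for rapidly decreasing exact eigenvectors.**
If `⇑v` is rapidly decreasing and `linOp ν Uv π P v = λ • v` (`λ ∈ ℝ`), then
`‖P_n (linOp (P_n v)) − λ P_n v‖ → 0` along the cube truncations `P_n = cubeProj n`. -/
theorem tendsto_eigen_residual (hUv : RapidDecay Uv) (hπ : ∀ j, ‖π j‖ ≤ 1) (hP : ∀ k, ‖P k‖ ≤ 1)
    {v : lp (fun _ : (d → ℤ) => V) 2} (hv : RapidDecay (⇑v)) {lam : ℝ}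
    (heig : linOp ν Uv π P v = lam • v) :
    Tendsto (fun n => ‖cubeProj n (linOp ν Uv π P (cubeProj n v)) - lam • cubeProj n v‖) atTop (𝓝 0) := by
  -- the constant
  obtain ⟨K, hK⟩ : ∃ K : ℝ≥0∞, K =
      ‖(ν : ℂ)‖ₑ * ((Fintype.card d : ℝ≥0∞) * (ENNReal.ofReal (2 * Real.pi) * ENNReal.ofReal (2 * Real.pi)))
        + (∑ j, ENNReal.ofReal ((2 : ℝ) ^ (|(2 : ℝ)| / 2)) *
            symbNorm |(2 : ℝ)| (scal (fun p => π j (Uv p)) : (d → ℤ) → (V →L[ℂ] V))) * ENNReal.ofReal (2 * Real.pi)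
        + 2 * ((Fintype.card d : ℝ≥0∞) * ENNReal.ofReal (2 * Real.pi)) *
            (∑' l, ENNReal.ofReal (sobolevWeight 3 l) * ‖Uv l‖ₑ) := ⟨_, rfl⟩
  have hKtop : K < ∞ := hK ▸ linConst_lt_top hUv
  have hK2 : K ^ 2 ≠ ∞ := (ENNReal.pow_lt_top hKtop).ne
  -- the residual is the truncation of `A (P_n v) − A v`
  have hPv : ∀ n : ℕ, RapidDecay (⇑(cubeProj n v)) := fun n => by
    rw [cubeProj_eq, coe_lpProj_eq_trunc]; exact rapidDecay_trunc _ _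
  have hid : ∀ n : ℕ, cubeProj n (linOp ν Uv π P (cubeProj n v)) - lam • cubeProj n v =
      cubeProj n (linOp ν Uv π P (cubeProj n v) - linOp ν Uv π P v) := fun n => by
    rw [map_sub, heig, ContinuousLinearMap.map_smul]
  -- the upper bound `b n`
  have h2v : eNormSq 2 (⇑v) < ∞ := eNormSq_lt_top_of_rapidDecay hv 2
  have hvt : ∀ n : ℕ, eNormSq 2 (⇑v - ⇑(cubeProj n v)) ≤ eNormSq 2 (⇑v) := fun n =>
    eNormSq_le_of_norm_le_norm fun k => by
      rw [cubeProj_eq, coe_lpProj_eq_trunc, Pi.sub_apply, trunc_apply]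
      split_ifs <;> simp
  set b : ℕ → ℝ≥0∞ := fun n => K ^ 2 * eNormSq 2 (⇑v - ⇑(cubeProj n v)) with hb
  have hbtop : ∀ n, b n ≠ ∞ := fun n => ENNReal.mul_ne_top hK2 ((hvt n).trans_lt h2v).ne
  -- the estimate `‖r n‖ ≤ √(b n)`
  have hle : ∀ n : ℕ, ‖cubeProj n (linOp ν Uv π P (cubeProj n v)) - lam • cubeProj n v‖ ≤
      Real.sqrt (b n).toReal := fun n => by
    rw [hid n]
    refine (norm_lpProj_le _ _).trans (norm_le_sqrt_toReal (hbtop n) ?_)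
    have h := eNormSq_linOp_sub_le (ν := ν) hUv hπ hP (hPv n) hv
    rw [← hK, eNormSq_sub_comm] at h
    exact h
  -- the limit `b n → 0`
  have hlim : Tendsto b atTop (𝓝 0) := by
    have h := ENNReal.Tendsto.const_mul (tendsto_eNormSq_sub_cubeProj (s := 2) h2v) (Or.inr hK2)
    rw [mul_zero] at h
    exact h
  have hlim' : Tendsto (fun n => Real.sqrt (b n).toReal) atTop (𝓝 0) := by
    have ht : Tendsto (fun n => (b n).toReal) atTop (𝓝 0) := by
      have h := (ENNReal.tendsto_toReal ENNReal.zero_ne_top).comp hlim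
      rwa [ENNReal.toReal_zero] at h
    have h := (Real.continuous_sqrt.tendsto 0).comp ht
    rwa [Real.sqrt_zero] at h
  exact tendsto_of_tendsto_of_tendsto_of_le_of_le tendsto_const_nhds hlim' (fun n => norm_nonneg _) hle

end Consistency

/-! ## §3 Seeds: small real multiples of a constrained rapidly decreasing element lie in the box -/

section Seeds

variable {ρ : (d → ℤ) → ℝ}

omit [Fintype d] [DecidableEq d] [CompleteSpace V] in
/-- Coordinates of a real multiple: `(ε • x) k = (ε : ℂ) • x k`. -/
theorem coe_real_smul_apply [Fintype d] (ε : ℝ) (x : lp (fun _ : (d → ℤ) => V) 2) (k : d → ℤ) :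
    (ε • x) k = (ε : ℂ) • x k := by
  rw [lp.coeFn_smul, Pi.smul_apply, Complex.coe_smul]

omit [DecidableEq d] [CompleteSpace V] in
/-- **Real multiples of a constrained element lie in the box when the radii allow.** If `x`
satisfies the three linear constraints of `box ρ π P` (`P`-fixed, real through `π`, divergence-free
through `π`) and `|ε|·‖x k‖ ≤ ρ k` for every mode, then `ε • x ∈ box ρ π P`. -/
theorem smul_mem_box {x : lp (fun _ : (d → ℤ) => V) 2}
    (hPx : ∀ k, P k (x k) = x k) (hreal : ∀ j k, π j (x (-k)) = conj (π j (x k)))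
    (hdiv : ∀ k, ∑ j, ((k j : ℤ) : ℂ) * π j (x k) = 0) {ε : ℝ} (hε : ∀ k, |ε| * ‖x k‖ ≤ ρ k) :
    ε • x ∈ box ρ π P := by
  refine mem_box.2 ⟨fun k => ?_, fun k => ?_, fun j k => ?_, fun k => ?_⟩
  · rw [coe_real_smul_apply, norm_smul, Complex.norm_real, Real.norm_eq_abs]; exact hε k
  · rw [coe_real_smul_apply, map_smul, hPx]
  · rw [coe_real_smul_apply, coe_real_smul_apply, map_smul, map_smul, hreal, smul_eq_mul, smul_eq_mul,
      map_mul, Complex.conj_ofReal]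
  · calc ∑ j, ((k j : ℤ) : ℂ) * π j ((ε • x) k) = (ε : ℂ) * ∑ j, ((k j : ℤ) : ℂ) * π j (x k) := by
          rw [Finset.mul_sum]
          exact Finset.sum_congr rfl fun j _ => by rw [coe_real_smul_apply, map_smul, smul_eq_mul]; ring
      _ = 0 := by rw [hdiv k, mul_zero]

omit [DecidableEq d] [CompleteSpace V] in
/-- **The seed hypothesis is satisfiable.** For a rapidly decreasing `x ∈ E` satisfying the three
linear constraints and radii with a polynomial floor `C·⟨k⟩^{−s} ≤ ρ k` (`C > 0`), every real multiple
`ε • x` with `|ε| ≤ ε₀` lies in `box ρ π P`, for some `ε₀ > 0` (`ε₀ = C/(B+1)`,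
`B = ∑_l ⟨l⟩^s ‖x l‖ < ∞`). -/
theorem exists_smul_mem_box_of_rapidDecay {x : lp (fun _ : (d → ℤ) => V) 2} (hx : RapidDecay (⇑x))
    (hPx : ∀ k, P k (x k) = x k) (hreal : ∀ j k, π j (x (-k)) = conj (π j (x k)))
    (hdiv : ∀ k, ∑ j, ((k j : ℤ) : ℂ) * π j (x k) = 0) {C s : ℝ} (hC : 0 < C)
    (hρ : ∀ k, C * sobolevWeight (-s) k ≤ ρ k) :
    ∃ ε₀ : ℝ, 0 < ε₀ ∧ ∀ ε : ℝ, |ε| ≤ ε₀ → ε • x ∈ box ρ π P := by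
  obtain ⟨m, hm⟩ := exists_nat_ge s
  have hle1 : ∀ k, sobolevWeight s k * ‖x k‖ ≤ (1 + freqNormSq k) ^ m * ‖x k‖ := fun k => by
    refine mul_le_mul_of_nonneg_right ?_ (norm_nonneg _)
    have h1 : 1 ≤ sobolevWeight (m : ℝ) k := one_le_sobolevWeight (Nat.cast_nonneg m) k
    calc sobolevWeight s k ≤ sobolevWeight (m : ℝ) k := sobolevWeight_mono hm k
      _ ≤ sobolevWeight (m : ℝ) k ^ 2 := le_self_pow₀ h1 two_ne_zero
      _ = (1 + freqNormSq k) ^ m := sobolevWeight_natCast_sq m k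
  have hsum : Summable fun k => sobolevWeight s k * ‖x k‖ :=
    Summable.of_nonneg_of_le (fun k => mul_nonneg (sobolevWeight_pos s k).le (norm_nonneg _)) hle1 (hx m)
  set B := ∑' l, sobolevWeight s l * ‖x l‖ with hB
  have hB0 : 0 ≤ B := tsum_nonneg fun l => mul_nonneg (sobolevWeight_pos s l).le (norm_nonneg _)
  have hBk : ∀ k, sobolevWeight s k * ‖x k‖ ≤ B := fun k =>
    hsum.le_tsum k fun l _ => mul_nonneg (sobolevWeight_pos s l).le (norm_nonneg _)
  refine ⟨C / (B + 1), div_pos hC (by linarith), fun ε hε => smul_mem_box hPx hreal hdiv fun k => ?_⟩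
  have hw : ‖x k‖ = sobolevWeight (-s) k * (sobolevWeight s k * ‖x k‖) := by
    rw [← mul_assoc, sobolevWeight_neg, inv_mul_cancel₀ (sobolevWeight_pos s k).ne', one_mul]
  rw [hw]
  have hw0 : 0 ≤ sobolevWeight (-s) k := (sobolevWeight_pos _ _).le
  calc |ε| * (sobolevWeight (-s) k * (sobolevWeight s k * ‖x k‖))
      ≤ C / (B + 1) * (sobolevWeight (-s) k * B) :=
        mul_le_mul hε (mul_le_mul_of_nonneg_left (hBk k) hw0)
          (mul_nonneg hw0 (mul_nonneg (sobolevWeight_pos _ _).le (norm_nonneg _))) (div_nonneg hC.le (by linarith))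
    _ = C * sobolevWeight (-s) k * (B / (B + 1)) := by ring
    _ ≤ C * sobolevWeight (-s) k * 1 :=
        mul_le_mul_of_nonneg_left ((div_le_one (by linarith)).2 (by linarith)) (mul_nonneg hC.le hw0)
    _ ≤ ρ k := by rw [mul_one]; exact hρ k

end Seeds

end Summit.NavierStokesRegularity.FluidComputer.TransportGalerkinEigen

end
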